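import Summits.KontsevichZagierPeriods.KontsevichZagierPeriods.Theorems.SoloBlindLegendreForm
import Summits.KontsevichZagierPeriods.KontsevichZagierPeriods.Theorems.SoloBlindEllipticCells
import Literature.NumberTheory.Transcendental.KZSemiCanonicalReductionProofs
import HarnessLib

/-!
# Legendre's relation inside the rules, II: the modulus band

The deformation of part III lives on the **modulus band**

  `B = (0,1)² × [m₁, m₂] ⊆ ℝ³`,  coordinates `(x, y, μ)`,  `0 < m₁ ≤ m₂ < 1` algebraic

(`ModBand`), together with its two closures `B_x` (`0 ≤ x ≤ 1`) and `B_y` (`0 ≤ y ≤ 1`) in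
the flux directions, the flux base `(0,1) × [m₁, m₂]` and the open square `(0,1)²`.  This
file records that these sets are `ℚ`-semialgebraic, that `B_x ∖ B`, `B_y ∖ B` are null,
and the domination principle used in part III for all integrands of the construction: a
measurable function bounded by `const · (1-x)^{-1/2} (1-y)^{-1/2}` (a product of Beta
integrands, integrable by Fubini on the product set) is integrable on the band, resp. on the
square (`integrableOn_band_of_le`, `integrableOn_usq_of_le`).
-/

noncomputable section

namespace Summit.KontsevichZagierPeriods.KontsevichZagierPeriods.Theorems

open Set MeasureTheory
open Literature.ModelTheory.ExponentialFields (IsSemialgebraic isSemialgebraic_setOf_eval_pos)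
open Literature.ModelTheory.ExponentialFields (isSemialgebraic_setOf_eval_lt)
open Literature.ModelTheory.ExponentialFields (isSemialgebraic_setOf_eval_nonneg)
open Literature.ModelTheory.ExponentialFields (isSemialgebraic_setOf_eval_le)
open MvPolynomial (aeval X)
open Literature.NumberTheory.Transcendental
open Literature.NumberTheory.Transcendental.KZ
open Literature.Analysis.SpecialFunctions.Selberg

namespace SoloBlind

/-- A **modulus band** `[m₁, m₂] ⊆ (0,1)` with real algebraic ends. -/
structure ModBand where
  /-- lower modulus-square -/
  lo : ℝ
  /-- upper modulus-square -/
  hi : ℝ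
  /-- `m₁` is algebraic -/
  lo_alg : IsAlgebraic ℚ lo
  /-- `m₂` is algebraic -/
  hi_alg : IsAlgebraic ℚ hi
  /-- `0 < m₁` -/
  lo_pos : 0 < lo
  /-- `m₁ ≤ m₂` -/
  lo_le_hi : lo ≤ hi
  /-- `m₂ < 1` -/
  hi_lt_one : hi < 1

namespace ModBand

variable (c : ModBand)

/-- `m₂ > 0`. -/
theorem hi_pos : 0 < c.hi := c.lo_pos.trans_le c.lo_le_hi

/-- `m₁ < 1`. -/
theorem lo_lt_one : c.lo < 1 := c.lo_le_hi.trans_lt c.hi_lt_one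

/-- `[m₁, m₂] ⊆ (0,1)`. -/
theorem mem_Ioo {μ : ℝ} (h : μ ∈ Icc c.lo c.hi) : μ ∈ Ioo (0:ℝ) 1 :=
  ⟨c.lo_pos.trans_le h.1, h.2.trans_lt c.hi_lt_one⟩

/-- The reflected band `[1-m₂, 1-m₁]` (exchanging the roles of `x` and `y`). -/
def symm : ModBand where
  lo := 1 - c.hi
  hi := 1 - c.lo
  lo_alg := isAlgebraic_one.sub c.hi_alg
  hi_alg := isAlgebraic_one.sub c.lo_alg
  lo_pos := sub_pos.mpr c.hi_lt_one
  lo_le_hi := by linarith [c.lo_le_hi]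
  hi_lt_one := sub_lt_self _ c.lo_pos

end ModBand

/-! ## Cutting by non-strict inequalities with algebraic constants -/

/-- Cutting a semialgebraic set by `t i ≤ a`, `a` algebraic. -/
theorem isSemialgebraic_sep_apply_le {n : ℕ} {S : Set (Fin n → ℝ)}
    (hS : IsSemialgebraic ℚ S) (i : Fin n) {a : ℝ} (ha : IsAlgebraic ℚ a) :
    IsSemialgebraic ℚ {t | t ∈ S ∧ t i ≤ a} := by
  convert ((isSemialgebraicFunOn_const_of_isAlgebraic hS ha).sub_holds
    (isSemialgebraicFunOn_aeval hS (X i))).isSemialgebraic_sep_nonneg using 2 with t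
  simp [sub_nonneg]

/-- Cutting a semialgebraic set by `a ≤ t i`, `a` algebraic. -/
theorem isSemialgebraic_sep_le_apply {n : ℕ} {S : Set (Fin n → ℝ)}
    (hS : IsSemialgebraic ℚ S) (i : Fin n) {a : ℝ} (ha : IsAlgebraic ℚ a) :
    IsSemialgebraic ℚ {t | t ∈ S ∧ a ≤ t i} := by
  convert ((isSemialgebraicFunOn_aeval hS (X i)).sub_holds
    (isSemialgebraicFunOn_const_of_isAlgebraic hS ha)).isSemialgebraic_sep_nonneg using 2 with t
  simp [sub_nonneg]

/-! ## The sets -/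

/-- The open unit square `(0,1)²`, coordinates `(x, y)`. -/
def usq : Set (Fin 2 → ℝ) := {w | (0 < w 0 ∧ w 0 < 1) ∧ (0 < w 1 ∧ w 1 < 1)}

/-- The modulus band `B = (0,1)² × [m₁, m₂]`, coordinates `(x, y, μ)`. -/
def band (c : ModBand) : Set (Fin 3 → ℝ) :=
  {z | ((0 < z 0 ∧ z 0 < 1) ∧ (0 < z 1 ∧ z 1 < 1)) ∧ c.lo ≤ z 2 ∧ z 2 ≤ c.hi}

/-- The band closed in the `x`-direction, `B_x = [0,1] × (0,1) × [m₁, m₂]`. -/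
def bandX (c : ModBand) : Set (Fin 3 → ℝ) :=
  {z | ((0 ≤ z 0 ∧ z 0 ≤ 1) ∧ (0 < z 1 ∧ z 1 < 1)) ∧ c.lo ≤ z 2 ∧ z 2 ≤ c.hi}

/-- The band closed in the `y`-direction, `B_y = (0,1) × [0,1] × [m₁, m₂]`. -/
def bandY (c : ModBand) : Set (Fin 3 → ℝ) :=
  {z | ((0 < z 0 ∧ z 0 < 1) ∧ (0 ≤ z 1 ∧ z 1 ≤ 1)) ∧ c.lo ≤ z 2 ∧ z 2 ≤ c.hi}

/-- The flux base `(0,1) × [m₁, m₂]`, coordinates `(other variable, μ)`. -/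
def base (c : ModBand) : Set (Fin 2 → ℝ) :=
  {v | (0 < v 0 ∧ v 0 < 1) ∧ c.lo ≤ v 1 ∧ v 1 ≤ c.hi}

variable (c : ModBand)

/-- The open square is `ℚ`-semialgebraic. -/
theorem isSemialgebraic_usq : IsSemialgebraic ℚ usq := by
  have h0 := isSemialgebraic_setOf_eval_pos (R := ℝ) (X 0 : MvPolynomial (Fin 2) ℚ)
  have h1 := isSemialgebraic_setOf_eval_lt (R := ℝ) (X 0 : MvPolynomial (Fin 2) ℚ) 1
  have h2 := isSemialgebraic_setOf_eval_pos (R := ℝ) (X 1 : MvPolynomial (Fin 2) ℚ)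
  have h3 := isSemialgebraic_setOf_eval_lt (R := ℝ) (X 1 : MvPolynomial (Fin 2) ℚ) 1
  convert (h0.inter h1).inter (h2.inter h3) using 1
  all_goals first | rfl | (ext w; simp [usq])

/-- The open part `(0,1)² × ℝ` of the band is `ℚ`-semialgebraic. -/
theorem isSemialgebraic_cyl : IsSemialgebraic ℚ
    {z : Fin 3 → ℝ | (0 < z 0 ∧ z 0 < 1) ∧ (0 < z 1 ∧ z 1 < 1)} := by
  have h0 := isSemialgebraic_setOf_eval_pos (R := ℝ) (X 0 : MvPolynomial (Fin 3) ℚ)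
  have h1 := isSemialgebraic_setOf_eval_lt (R := ℝ) (X 0 : MvPolynomial (Fin 3) ℚ) 1
  have h2 := isSemialgebraic_setOf_eval_pos (R := ℝ) (X 1 : MvPolynomial (Fin 3) ℚ)
  have h3 := isSemialgebraic_setOf_eval_lt (R := ℝ) (X 1 : MvPolynomial (Fin 3) ℚ) 1
  convert (h0.inter h1).inter (h2.inter h3) using 1
  all_goals first | rfl | (ext z; simp)

/-- The band is `ℚ`-semialgebraic. -/
theorem isSemialgebraic_band : IsSemialgebraic ℚ (band c) := by
  convert isSemialgebraic_sep_apply_le (isSemialgebraic_sep_le_apply isSemialgebraic_cyl 2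
    c.lo_alg) 2 c.hi_alg using 1
  ext z
  simp only [band, mem_setOf_eq, and_assoc]

/-- `B_x` is `ℚ`-semialgebraic. -/
theorem isSemialgebraic_bandX : IsSemialgebraic ℚ (bandX c) := by
  have h0 := isSemialgebraic_setOf_eval_nonneg (R := ℝ) (X 0 : MvPolynomial (Fin 3) ℚ)
  have h1 := isSemialgebraic_setOf_eval_le (R := ℝ) (X 0 : MvPolynomial (Fin 3) ℚ) 1
  have h2 := isSemialgebraic_setOf_eval_pos (R := ℝ) (X 1 : MvPolynomial (Fin 3) ℚ)
  have h3 := isSemialgebraic_setOf_eval_lt (R := ℝ) (X 1 : MvPolynomial (Fin 3) ℚ) 1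
  have h : IsSemialgebraic ℚ
      {z : Fin 3 → ℝ | (0 ≤ z 0 ∧ z 0 ≤ 1) ∧ (0 < z 1 ∧ z 1 < 1)} := by
    convert (h0.inter h1).inter (h2.inter h3) using 1
    all_goals first | rfl | (ext z; simp)
  convert isSemialgebraic_sep_apply_le (isSemialgebraic_sep_le_apply h 2 c.lo_alg) 2
    c.hi_alg using 1
  ext z
  simp only [bandX, mem_setOf_eq, and_assoc]

/-- `B_y` is `ℚ`-semialgebraic. -/
theorem isSemialgebraic_bandY : IsSemialgebraic ℚ (bandY c) := by
  have h0 := isSemialgebraic_setOf_eval_pos (R := ℝ) (X 0 : MvPolynomial (Fin 3) ℚ)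
  have h1 := isSemialgebraic_setOf_eval_lt (R := ℝ) (X 0 : MvPolynomial (Fin 3) ℚ) 1
  have h2 := isSemialgebraic_setOf_eval_nonneg (R := ℝ) (X 1 : MvPolynomial (Fin 3) ℚ)
  have h3 := isSemialgebraic_setOf_eval_le (R := ℝ) (X 1 : MvPolynomial (Fin 3) ℚ) 1
  have h : IsSemialgebraic ℚ
      {z : Fin 3 → ℝ | (0 < z 0 ∧ z 0 < 1) ∧ (0 ≤ z 1 ∧ z 1 ≤ 1)} := by
    convert (h0.inter h1).inter (h2.inter h3) using 1
    all_goals first | rfl | (ext z; simp)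
  convert isSemialgebraic_sep_apply_le (isSemialgebraic_sep_le_apply h 2 c.lo_alg) 2
    c.hi_alg using 1
  ext z
  simp only [bandY, mem_setOf_eq, and_assoc]

/-- The flux base is `ℚ`-semialgebraic. -/
theorem isSemialgebraic_base : IsSemialgebraic ℚ (base c) := by
  have h0 := isSemialgebraic_setOf_eval_pos (R := ℝ) (X 0 : MvPolynomial (Fin 2) ℚ)
  have h1 := isSemialgebraic_setOf_eval_lt (R := ℝ) (X 0 : MvPolynomial (Fin 2) ℚ) 1
  have h : IsSemialgebraic ℚ {v : Fin 2 → ℝ | 0 < v 0 ∧ v 0 < 1} := by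
    convert h0.inter h1 using 1
    all_goals first | rfl | (ext v; simp)
  convert isSemialgebraic_sep_apply_le (isSemialgebraic_sep_le_apply h 1 c.lo_alg) 1
    c.hi_alg using 1
  ext v
  simp only [base, mem_setOf_eq, and_assoc]

/-! ## Null sets and product structure -/

/-- `B ⊆ B_x`. -/
theorem band_subset_bandX : band c ⊆ bandX c := fun _ hz =>
  ⟨⟨⟨hz.1.1.1.le, hz.1.1.2.le⟩, hz.1.2⟩, hz.2⟩

/-- `B ⊆ B_y`. -/
theorem band_subset_bandY : band c ⊆ bandY c := fun _ hz =>
  ⟨⟨hz.1.1, ⟨hz.1.2.1.le, hz.1.2.2.le⟩⟩, hz.2⟩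

/-- `B_x ∖ B` is null (it lies in `{x = 0} ∪ {x = 1}`). -/
theorem volume_bandX_diff : volume (bandX c \ band c) = 0 := by
  have hp : ∀ a : ℝ, volume {z : Fin 3 → ℝ | z 0 = a} = 0 := fun a => by
    rw [MeasureTheory.volume_pi]
    exact Measure.pi_hyperplane (fun _ : Fin 3 => (volume : Measure ℝ)) (0 : Fin 3) a
  refine measure_mono_null (fun z ⟨hX, hB⟩ => ?_) (measure_union_null (hp 0) (hp 1))
  by_contra h
  simp only [mem_union, mem_setOf_eq, not_or] at h
  exact hB ⟨⟨⟨lt_of_le_of_ne hX.1.1.1 (Ne.symm h.1), lt_of_le_of_ne hX.1.1.2 h.2⟩,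
    hX.1.2⟩, hX.2⟩

/-- `B_y ∖ B` is null (it lies in `{y = 0} ∪ {y = 1}`). -/
theorem volume_bandY_diff : volume (bandY c \ band c) = 0 := by
  have hp : ∀ a : ℝ, volume {z : Fin 3 → ℝ | z 1 = a} = 0 := fun a => by
    rw [MeasureTheory.volume_pi]
    exact Measure.pi_hyperplane (fun _ : Fin 3 => (volume : Measure ℝ)) (1 : Fin 3) a
  refine measure_mono_null (fun z ⟨hY, hB⟩ => ?_) (measure_union_null (hp 0) (hp 1))
  by_contra h
  simp only [mem_union, mem_setOf_eq, not_or] at h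
  exact hB ⟨⟨hY.1.1, ⟨lt_of_le_of_ne hY.1.2.1 (Ne.symm h.1),
    lt_of_le_of_ne hY.1.2.2 h.2⟩⟩, hY.2⟩

/-- `B_x` and `B` agree up to a null set. -/
theorem bandX_ae_eq : bandX c =ᵐ[volume] band c :=
  ae_eq_set.mpr ⟨volume_bandX_diff c,
    measure_mono_null (fun _ hz => (hz.2 (band_subset_bandX c hz.1)).elim) measure_empty⟩

/-- `B_y` and `B` agree up to a null set. -/
theorem bandY_ae_eq : bandY c =ᵐ[volume] band c :=
  ae_eq_set.mpr ⟨volume_bandY_diff c,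
    measure_mono_null (fun _ hz => (hz.2 (band_subset_bandY c hz.1)).elim) measure_empty⟩

/-- The band is a product of intervals. -/
theorem band_eq_pi : band c = Set.pi univ ![Ioo 0 1, Ioo 0 1, Icc c.lo c.hi] := by
  ext z
  simp only [band, mem_setOf_eq, mem_univ_pi, Fin.forall_fin_succ, IsEmpty.forall_iff,
    and_true, mem_Ioo, mem_Icc, Matrix.cons_val_zero, Matrix.cons_val_succ, and_assoc]
  exact Iff.rfl

/-- The square is a product of intervals. -/
theorem usq_eq_pi : usq = Set.pi univ ![Ioo (0:ℝ) 1, Ioo 0 1] := by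
  ext w
  simp only [usq, mem_setOf_eq, mem_univ_pi, Fin.forall_fin_succ, IsEmpty.forall_iff,
    and_true, mem_Ioo, Matrix.cons_val_zero, Matrix.cons_val_succ, and_assoc]
  exact Iff.rfl

/-! ## Integrability by domination with a product of Beta integrands -/

/-- **Integrability on the band by domination.** A measurable `g` with
`|g| ≤ K·(1-x)^{-1/2}(1-y)^{-1/2}` on `B` is integrable on `B`. -/
theorem integrableOn_band_of_le {g : (Fin 3 → ℝ) → ℝ} (hg : Measurable g) (K : ℝ)
    (hle : ∀ z ∈ band c, |g z| ≤ K * (1 / Real.sqrt (1 - z 0) * (1 / Real.sqrt (1 - z 1)))) :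
    IntegrableOn g (band c) := by
  have h1 := integrableOn_one_div_sqrt_one_sub'
  have hD : Integrable (fun z : Fin 3 → ℝ =>
      K * (1 / Real.sqrt (1 - z 0) * (1 / Real.sqrt (1 - z 1)))) (volume.restrict (band c)) := by
    rw [band_eq_pi, MeasureTheory.volume_pi, Measure.restrict_pi_pi]
    have h := MeasureTheory.Integrable.fintype_prod
      (f := ![fun x => 1 / Real.sqrt (1 - x), fun y => 1 / Real.sqrt (1 - y), fun _ => (1:ℝ)])
      (μ := fun i => (volume : Measure ℝ).restrict (![Ioo 0 1, Ioo 0 1, Icc c.lo c.hi] i))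
      (fun i => by
        fin_cases i
        · exact h1
        · exact h1
        · exact (integrableOn_const (C := (1:ℝ)) measure_Icc_lt_top.ne :
            IntegrableOn (fun _ => (1:ℝ)) (Icc c.lo c.hi)))
    refine (h.const_mul K).congr (ae_of_all _ fun z => ?_)
    simp [Fin.prod_univ_succ]
  refine Integrable.mono' hD hg.aestronglyMeasurable ?_
  exact (ae_restrict_iff'
    (Literature.ModelTheory.ExponentialFields.IsSemialgebraic.measurableSet_holds
    (isSemialgebraic_band c))).mpr
    (Filter.Eventually.of_forall fun z hz => (Real.norm_eq_abs _).trans_le (hle z hz))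

/-- **Integrability on the square by domination.** -/
theorem integrableOn_usq_of_le {g : (Fin 2 → ℝ) → ℝ} (hg : Measurable g) (K : ℝ)
    (hle : ∀ w ∈ usq, |g w| ≤ K * (1 / Real.sqrt (1 - w 0) * (1 / Real.sqrt (1 - w 1)))) :
    IntegrableOn g usq := by
  have h1 := integrableOn_one_div_sqrt_one_sub'
  have hD : Integrable (fun w : Fin 2 → ℝ =>
      K * (1 / Real.sqrt (1 - w 0) * (1 / Real.sqrt (1 - w 1)))) (volume.restrict usq) := by
    rw [usq_eq_pi, MeasureTheory.volume_pi, Measure.restrict_pi_pi]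
    have h := MeasureTheory.Integrable.fintype_prod
      (f := ![fun x => 1 / Real.sqrt (1 - x), fun y => 1 / Real.sqrt (1 - y)])
      (μ := fun i => (volume : Measure ℝ).restrict (![Ioo 0 1, Ioo 0 1] i))
      (fun i => by fin_cases i <;> exact h1)
    refine (h.const_mul K).congr (ae_of_all _ fun w => ?_)
    simp [Fin.prod_univ_succ]
  refine Integrable.mono' hD hg.aestronglyMeasurable ?_
  exact (ae_restrict_iff'
    (Literature.ModelTheory.ExponentialFields.IsSemialgebraic.measurableSet_holds
    isSemialgebraic_usq)).mpr
    (Filter.Eventually.of_forall fun w hw => (Real.norm_eq_abs _).trans_le (hle w hw))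

end SoloBlind

end Summit.KontsevichZagierPeriods.KontsevichZagierPeriods.Theorems
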